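import Summits.Ventures.YMGap.Thresholds.OneLinkSDVariance
import Summits.Ventures.YMGap.Thresholds.OneLinkOmega
import HarnessLib

/-!
# Venture YMGap — the one-link modulus beyond first order, part 33: SECOND MOMENTS OF QUADRATIC WORDS `tr(gM₁gM₂)` by
# Schwinger–Dyson (Haar scale), for every `B`

HONEST FRAMING: venture file of the cell `pub-ymgap` (QuantumFields programme), strong-coupling LATTICE bookkeeping for `SU(N)`
lattice Yang–Mills; nothing about the continuum or the mass gap in the Clay sense.  No number of record moves here: this is a new
primitive for the level-two one-link modulus (the `L²(ν_B)` norms of the quadratic words `w = tr(gΔgB)`, `w_BB = tr(gBgB)` that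
the cubic-remainder gradient majorant `OneLinkRemainderGradientL2.c3bound_le_affine` bounds by their SUP norms `‖Δ‖_F‖B‖_F`,
`‖B‖_F²`; cell note `HOME/p2/ONE-LINK-HIERARCHY.md` §13 option (2), quadratic half).

WHAT.  `ν_B(dg) ∝ exp(N Re tr(gB)) dg` on `SU(N)`, `N ≥ 3`, `a = 2N − 4/N` (the `Sym²/Λ²` Casimir average), `w = tr(gM₁gM₂)`,
`Z_M = √(E_ν|tr(gM)|²)`, `W = √(E_ν|w|²)`.  The Schwinger–Dyson identity `E_ν[Δ|w|² + NΓ(Re tr(·B), |w|²)] = 0` with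
`Δ Re w = −a Re w − 2Re(tr(gM₁)tr(gM₂))` (`OneLinkCasimirTwo.Lap_reTrQuad`), the feedback rule `OneLinkFeedback.Gam_potB_reTrQuad`
(whose `(2/N)·Im tr(Bg)` term CANCELS in `Re w·Γ(·,Re w) + Im w·Γ(·,Im w)`), and the gradient bound
`Γ(Re w) + Γ(Im w) ≤ ‖M₁gM₂ + M₂gM₁‖_F²` give
* `quad_sd_sq_le`: `a·W² ≤ γ² + 2‖M₁‖_F‖M₂‖_F Z_{M₁}Z_{M₂} + (N/2)(κ + Z_{M₂BᴴM₁} + Z_{M₁BᴴM₂})·W` for any pointwise bounds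
  `‖M₁gM₂ + M₂gM₁‖_F ≤ γ`, `|tr(BgM₁gM₂g)| + |tr(BgM₂gM₁g)| ≤ κ`;
* `sqrt_integral_normSq_quadDB_le`, `sqrt_integral_normSq_quadBB_le`: with `r = ‖B‖_op`, `s_B = ‖B‖_F/2 + √(‖B‖_F²/4 + 1/N)`
  (the scale of `OneLinkSDVariance`), `b₀ = N r(‖B‖_F + r s_B)`, `c₀ = 4r² + 2‖B‖_F² s_B²`:
  `√E|tr(gΔgB)|² ≤ ‖Δ‖_F·(b₀/(2a) + √(b₀²/(4a²) + c₀/a))`, `√E|tr(gBgB)|² ≤ ‖B‖_F·(same)` — at `N = 10`, `r = 0.24`, `‖B‖_F = √N r`: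
  `0.30‖Δ‖_F` and `0.23` against the sup norms `0.76‖Δ‖_F` and `0.58`.

References: cell note `HOME/p2/ONE-LINK-HIERARCHY.md` §2 (2.1), (2.3), §13; Shen–Zhu–Zhu CMP 400 (2023) §4.1.
-/

noncomputable section

open scoped Matrix ComplexConjugate BigOperators ContDiff Matrix.Norms.Frobenius
open Matrix Complex Finset MeasureTheory ProbabilityTheory
open Literature.MathematicalPhysics.QuantumFieldTheory
open Literature.MathematicalPhysics.QuantumFieldTheory.SUNBakryEmery

namespace Summit.Ventures.YMGap.OneLinkEigen

variable {N : ℕ}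

/-! ### `−i`-rotated words: real parts become imaginary parts -/

/-- `Re((−i) z) = Im z`. [folklore] -/
theorem negI_mul_re (z : ℂ) : ((-I) * z).re = z.im := by
  rw [mul_re, neg_re, neg_im, I_re, I_im]; ring

/-- `Im((−i) z) = −Re z`. [folklore] -/
theorem negI_mul_im (z : ℂ) : ((-I) * z).im = -z.re := by
  rw [mul_im, neg_re, neg_im, I_re, I_im]; ring

/-- `Re tr(QM₁Q(−iM₂)) = Im tr(QM₁QM₂)`. [folklore] -/
theorem reTrQuad_negI (Q M₁ M₂ : Matrix (Fin N) (Fin N) ℂ) :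
    (Q * M₁ * Q * ((-I) • M₂)).trace.re = (Q * M₁ * Q * M₂).trace.im := by
  rw [Matrix.mul_smul, trace_smul, smul_eq_mul, negI_mul_re]

/-- `Im tr(QM₁Q(−iM₂)) = −Re tr(QM₁QM₂)`. [folklore] -/
theorem imTrQuad_negI (Q M₁ M₂ : Matrix (Fin N) (Fin N) ℂ) :
    (Q * M₁ * Q * ((-I) • M₂)).trace.im = -(Q * M₁ * Q * M₂).trace.re := by
  rw [Matrix.mul_smul, trace_smul, smul_eq_mul, negI_mul_im]

/-! ### The gradient of a quadratic word at a point is the gradient of a linear statistic -/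

/-- At `g ∈ SU(N)`: `Γ(Re tr(·M₁·M₂))(g) = Γ(Re tr(·M'))(g)` with `M' = M₁gM₂ + M₂gM₁`. [folklore] -/
theorem Gam_reTrQuad_eq_Gam_pot (M₁ M₂ : Matrix (Fin N) (Fin N) ℂ) (g : SUN N) :
    Gam (fun Q : Matrix (Fin N) (Fin N) ℂ => (Q * M₁ * Q * M₂).trace.re)
        (fun Q : Matrix (Fin N) (Fin N) ℂ => (Q * M₁ * Q * M₂).trace.re) g =
      Gam (pot 1 (M₁ * (g : Matrix (Fin N) (Fin N) ℂ) * M₂ + M₂ * (g : Matrix (Fin N) (Fin N) ℂ) * M₁))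
        (pot 1 (M₁ * (g : Matrix (Fin N) (Fin N) ℂ) * M₂ + M₂ * (g : Matrix (Fin N) (Fin N) ℂ) * M₁)) g := by
  set G : Matrix (Fin N) (Fin N) ℂ := (g : Matrix (Fin N) (Fin N) ℂ) with hG
  have hpt : ∀ α : FrameIdx N, matD (frame α) (fun Q : Matrix (Fin N) (Fin N) ℂ => (Q * M₁ * Q * M₂).trace.re) G =
      matD (frame α) (pot 1 (M₁ * G * M₂ + M₂ * G * M₁)) G := by
    intro α
    rw [matD_reTrQuad]
    have h2 : matD (frame α) (pot (N := N) 1 (M₁ * G * M₂ + M₂ * G * M₁)) =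
        fun Q => 1 * (Q * frame α * (M₁ * G * M₂ + M₂ * G * M₁)).trace.re := matD_const_mul_reTrMul 1 (frame α) _
    rw [h2]
    simp only [one_mul, Matrix.mul_add, trace_add, Complex.add_re]
    have e1 : (G * frame α * M₁ * G * M₂).trace.re = (G * frame α * (M₁ * G * M₂)).trace.re := by
      simp only [Matrix.mul_assoc]
    have e2 : (G * M₁ * G * frame α * M₂).trace.re = (G * frame α * (M₂ * G * M₁)).trace.re := by
      rw [show G * M₁ * G * frame α * M₂ = (G * M₁) * (G * frame α * M₂) by simp only [Matrix.mul_assoc],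
        trace_mul_comm]
      simp only [Matrix.mul_assoc]
    rw [e1, e2]
  simp only [Gam]
  exact sum_congr rfl fun α _ => by rw [hpt α]

/-- **`Γ(Re w, Re w) + Γ(Im w, Im w) ≤ ‖M₁gM₂ + M₂gM₁‖_F²` at `g ∈ SU(N)`** for `w = tr(gM₁gM₂)` (`Im w = Re tr(gM₁g(−iM₂))`).
[folklore] -/
theorem Gam_re_add_Gam_im_quad_le (hN : N ≠ 0) (M₁ M₂ : Matrix (Fin N) (Fin N) ℂ) (g : SUN N) :
    Gam (fun Q : Matrix (Fin N) (Fin N) ℂ => (Q * M₁ * Q * M₂).trace.re)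
        (fun Q : Matrix (Fin N) (Fin N) ℂ => (Q * M₁ * Q * M₂).trace.re) g +
      Gam (fun Q : Matrix (Fin N) (Fin N) ℂ => (Q * M₁ * Q * ((-I) • M₂)).trace.re)
        (fun Q : Matrix (Fin N) (Fin N) ℂ => (Q * M₁ * Q * ((-I) • M₂)).trace.re) g ≤
      frobNorm (M₁ * (g : Matrix (Fin N) (Fin N) ℂ) * M₂ + M₂ * (g : Matrix (Fin N) (Fin N) ℂ) * M₁) ^ 2 := by
  rw [Gam_reTrQuad_eq_Gam_pot, Gam_reTrQuad_eq_Gam_pot]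
  have e : M₁ * (g : Matrix (Fin N) (Fin N) ℂ) * ((-I) • M₂) + (-I) • M₂ * (g : Matrix (Fin N) (Fin N) ℂ) * M₁ =
      (-I) • (M₁ * (g : Matrix (Fin N) (Fin N) ℂ) * M₂ + M₂ * (g : Matrix (Fin N) (Fin N) ℂ) * M₁) := by
    rw [Matrix.mul_smul, Matrix.smul_mul, Matrix.smul_mul, smul_add]
  rw [e]
  exact Gam_re_add_Gam_im_le hN _ g

/-! ### The Schwinger–Dyson inequality for the second moment of a quadratic word -/

/-- **Second moment of a quadratic word by Schwinger–Dyson**, `N ≥ 3`, every `B, M₁, M₂`: with `a = 2N − 4/N`,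
`W = √E_ν|tr(gM₁gM₂)|²`, `Z_M = √E_ν|tr(gM)|²` and pointwise bounds `‖M₁gM₂ + M₂gM₁‖_F ≤ γ`,
`|tr(BgM₁gM₂g)| + |tr(BgM₂gM₁g)| ≤ κ` on `SU(N)`:
`a W² ≤ γ² + 2‖M₁‖_F‖M₂‖_F Z_{M₁}Z_{M₂} + (N/2)(κ + Z_{M₂BᴴM₁} + Z_{M₁BᴴM₂}) W`. [folklore] -/
theorem quad_sd_sq_le (hN : 3 ≤ N) (B M₁ M₂ : Matrix (Fin N) (Fin N) ℂ) {γ κ : ℝ}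
    (hγ : ∀ g : SUN N, frobNorm (M₁ * (g : Matrix (Fin N) (Fin N) ℂ) * M₂ + M₂ * (g : Matrix (Fin N) (Fin N) ℂ) * M₁) ≤ γ)
    (hκ : ∀ g : SUN N, ‖(B * (g : Matrix (Fin N) (Fin N) ℂ) * M₁ * g * M₂ * g).trace‖ +
      ‖(B * (g : Matrix (Fin N) (Fin N) ℂ) * M₂ * g * M₁ * g).trace‖ ≤ κ) :
    (2 * (N : ℝ) - 4 / N) * ∫ g, ‖((g : Matrix (Fin N) (Fin N) ℂ) * M₁ * g * M₂).trace‖ ^ 2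
        ∂(haarProbability (SUN N)).tilted (fun g => (N : ℝ) * ((g : Matrix (Fin N) (Fin N) ℂ) * B).trace.re) ≤
      γ ^ 2 + 2 * (frobNorm M₁ * frobNorm M₂) *
          (Real.sqrt (∫ g, ‖((g : Matrix (Fin N) (Fin N) ℂ) * M₁).trace‖ ^ 2
              ∂(haarProbability (SUN N)).tilted (fun g => (N : ℝ) * ((g : Matrix (Fin N) (Fin N) ℂ) * B).trace.re)) *
            Real.sqrt (∫ g, ‖((g : Matrix (Fin N) (Fin N) ℂ) * M₂).trace‖ ^ 2
              ∂(haarProbability (SUN N)).tilted (fun g => (N : ℝ) * ((g : Matrix (Fin N) (Fin N) ℂ) * B).trace.re)))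
        + (N : ℝ) / 2 * (κ +
            Real.sqrt (∫ g, ‖((g : Matrix (Fin N) (Fin N) ℂ) * (M₂ * Bᴴ * M₁)).trace‖ ^ 2
              ∂(haarProbability (SUN N)).tilted (fun g => (N : ℝ) * ((g : Matrix (Fin N) (Fin N) ℂ) * B).trace.re)) +
            Real.sqrt (∫ g, ‖((g : Matrix (Fin N) (Fin N) ℂ) * (M₁ * Bᴴ * M₂)).trace‖ ^ 2
              ∂(haarProbability (SUN N)).tilted (fun g => (N : ℝ) * ((g : Matrix (Fin N) (Fin N) ℂ) * B).trace.re))) *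
          Real.sqrt (∫ g, ‖((g : Matrix (Fin N) (Fin N) ℂ) * M₁ * g * M₂).trace‖ ^ 2
            ∂(haarProbability (SUN N)).tilted (fun g => (N : ℝ) * ((g : Matrix (Fin N) (Fin N) ℂ) * B).trace.re)) := by
  have hN0 : N ≠ 0 := by omega
  have h3 : (3 : ℝ) ≤ N := by exact_mod_cast hN
  have hNpos : (0 : ℝ) < N := by linarith
  set ν : Measure (SUN N) :=
    (haarProbability (SUN N)).tilted (fun g => (N : ℝ) * ((g : Matrix (Fin N) (Fin N) ℂ) * B).trace.re) with hν
  have hexpi : Integrable (fun g : SUN N => Real.exp ((N : ℝ) * ((g : Matrix (Fin N) (Fin N) ℂ) * B).trace.re))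
      (haarProbability (SUN N)) :=
    integrable_of_continuous_SUN (Real.continuous_exp.comp (continuous_restrict (contDiff_pot (N : ℝ) B))) _
  haveI : IsProbabilityMeasure ν := isProbabilityMeasure_tilted hexpi
  set a : ℝ := 2 * (N : ℝ) - 4 / N with ha
  -- the two real components of the word and the squared modulus
  set fr : Matrix (Fin N) (Fin N) ℂ → ℝ := fun Q => (Q * M₁ * Q * M₂).trace.re with hfr
  set fi : Matrix (Fin N) (Fin N) ℂ → ℝ := fun Q => (Q * M₁ * Q * ((-I) • M₂)).trace.re with hfi
  set F : Matrix (Fin N) (Fin N) ℂ → ℝ := fr * fr + fi * fi with hF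
  have hfrC : ContDiff ℝ ∞ fr := contDiff_reTrQuad M₁ M₂
  have hfiC : ContDiff ℝ ∞ fi := contDiff_reTrQuad M₁ ((-I) • M₂)
  have hFC : ContDiff ℝ ∞ F := (hfrC.mul hfrC).add (hfiC.mul hfiC)
  have hfi_eq : ∀ Q : Matrix (Fin N) (Fin N) ℂ, fi Q = (Q * M₁ * Q * M₂).trace.im := fun Q => reTrQuad_negI Q M₁ M₂
  have hF_eq : ∀ Q : Matrix (Fin N) (Fin N) ℂ, F Q = ‖(Q * M₁ * Q * M₂).trace‖ ^ 2 := by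
    intro Q
    simp only [hF, Pi.add_apply, Pi.mul_apply, hfi_eq, hfr]
    rw [Complex.sq_norm, Complex.normSq_apply]
  -- symbolic quantities
  set Z₁ : ℝ := Real.sqrt (∫ g, ‖((g : Matrix (Fin N) (Fin N) ℂ) * M₁).trace‖ ^ 2 ∂ν) with hZ₁
  set Z₂ : ℝ := Real.sqrt (∫ g, ‖((g : Matrix (Fin N) (Fin N) ℂ) * M₂).trace‖ ^ 2 ∂ν) with hZ₂
  set L₁ : ℝ := Real.sqrt (∫ g, ‖((g : Matrix (Fin N) (Fin N) ℂ) * (M₂ * Bᴴ * M₁)).trace‖ ^ 2 ∂ν) with hL₁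
  set L₂ : ℝ := Real.sqrt (∫ g, ‖((g : Matrix (Fin N) (Fin N) ℂ) * (M₁ * Bᴴ * M₂)).trace‖ ^ 2 ∂ν) with hL₂
  set W : ℝ := Real.sqrt (∫ g, ‖((g : Matrix (Fin N) (Fin N) ℂ) * M₁ * g * M₂).trace‖ ^ 2 ∂ν) with hW
  set σ : ℝ := frobNorm M₁ * frobNorm M₂ with hσ
  have hσ0 : 0 ≤ σ := mul_nonneg (frobNorm_nonneg _) (frobNorm_nonneg _)
  have hκ0 : 0 ≤ κ := (add_nonneg (norm_nonneg _) (norm_nonneg _)).trans (hκ 1)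
  have hγ0 : 0 ≤ γ := (frobNorm_nonneg _).trans (hγ 1)
  -- continuity of the atoms on `SU(N)`
  have cG : Continuous fun g : SUN N => (g : Matrix (Fin N) (Fin N) ℂ) := continuous_subtype_val
  have cw : Continuous fun g : SUN N => ((g : Matrix (Fin N) (Fin N) ℂ) * M₁ * g * M₂).trace :=
    (((cG.matrix_mul continuous_const).matrix_mul cG).matrix_mul continuous_const).matrix_trace
  have cz1 : Continuous fun g : SUN N => ((g : Matrix (Fin N) (Fin N) ℂ) * M₁).trace := (cG.matrix_mul continuous_const).matrix_trace
  have cz2 : Continuous fun g : SUN N => ((g : Matrix (Fin N) (Fin N) ℂ) * M₂).trace := (cG.matrix_mul continuous_const).matrix_trace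
  have cl1 : Continuous fun g : SUN N => ((g : Matrix (Fin N) (Fin N) ℂ) * (M₂ * Bᴴ * M₁)).trace :=
    (cG.matrix_mul continuous_const).matrix_trace
  have cl2 : Continuous fun g : SUN N => ((g : Matrix (Fin N) (Fin N) ℂ) * (M₁ * Bᴴ * M₂)).trace :=
    (cG.matrix_mul continuous_const).matrix_trace
  have cw3 : Continuous fun g : SUN N => (B * (g : Matrix (Fin N) (Fin N) ℂ) * M₁ * g * M₂ * g).trace :=
    (((((continuous_const.matrix_mul cG).matrix_mul continuous_const).matrix_mul cG).matrix_mul continuous_const).matrix_mul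
      cG).matrix_trace
  have cw3' : Continuous fun g : SUN N => (B * (g : Matrix (Fin N) (Fin N) ℂ) * M₂ * g * M₁ * g).trace :=
    (((((continuous_const.matrix_mul cG).matrix_mul continuous_const).matrix_mul cG).matrix_mul continuous_const).matrix_mul
      cG).matrix_trace
  -- (1) the pointwise Schwinger–Dyson integrand `H = ΔF + NΓ(Re tr(·B), F)` on `SU(N)`
  have hH : ∀ g : SUN N, Lap F g + (N : ℝ) * Gam (pot 1 B) F g =
      -2 * a * ‖((g : Matrix (Fin N) (Fin N) ℂ) * M₁ * g * M₂).trace‖ ^ 2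
        - 4 * ((starRingEnd ℂ) ((g : Matrix (Fin N) (Fin N) ℂ) * M₁ * g * M₂).trace *
            (((g : Matrix (Fin N) (Fin N) ℂ) * M₁).trace * ((g : Matrix (Fin N) (Fin N) ℂ) * M₂).trace)).re
        + 2 * (Gam fr fr g + Gam fi fi g)
        + (N : ℝ) * (-((starRingEnd ℂ) ((g : Matrix (Fin N) (Fin N) ℂ) * M₁ * g * M₂).trace *
              ((B * (g : Matrix (Fin N) (Fin N) ℂ) * M₁ * g * M₂ * g).trace +
                (B * (g : Matrix (Fin N) (Fin N) ℂ) * M₂ * g * M₁ * g).trace)).re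
            + ((starRingEnd ℂ) ((g : Matrix (Fin N) (Fin N) ℂ) * M₁ * g * M₂).trace *
              (((g : Matrix (Fin N) (Fin N) ℂ) * (M₂ * Bᴴ * M₁)).trace +
                ((g : Matrix (Fin N) (Fin N) ℂ) * (M₁ * Bᴴ * M₂)).trace)).re) := by
    intro g
    set G : Matrix (Fin N) (Fin N) ℂ := (g : Matrix (Fin N) (Fin N) ℂ) with hG
    -- Laplacian
    have hLap : Lap F G = fr G * Lap fr G + fr G * Lap fr G + 2 * Gam fr fr G
        + (fi G * Lap fi G + fi G * Lap fi G + 2 * Gam fi fi G) := by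
      have h1 : ContDiff ℝ ∞ (fr * fr) := hfrC.mul hfrC
      have h2 : ContDiff ℝ ∞ (fi * fi) := hfiC.mul hfiC
      rw [hF, Lap_add h1 h2, Pi.add_apply, Lap_mul hfrC hfrC, Lap_mul hfiC hfiC]
    have hLr : Lap fr G = -(a * fr G) - 2 * ((G * M₁).trace * (G * M₂).trace).re := by
      have h := congrFun (Lap_reTrQuad hN0 M₁ M₂) G
      rw [← ha] at h
      simpa only [hfr] using h
    have hLi : Lap fi G = -(a * fi G) - 2 * ((G * M₁).trace * (G * M₂).trace).im := by
      have h := congrFun (Lap_reTrQuad hN0 M₁ ((-I) • M₂)) G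
      rw [← ha] at h
      have e : ((G * M₁).trace * (G * ((-I) • M₂)).trace).re = ((G * M₁).trace * (G * M₂).trace).im := by
        rw [Matrix.mul_smul, trace_smul, smul_eq_mul, ← mul_assoc, mul_comm (G * M₁).trace (-I), mul_assoc, negI_mul_re]
      simpa only [hfi, e] using h
    -- carré du champ against the potential
    have hGamF : Gam (pot 1 B) F G = 2 * (fr G * Gam (pot 1 B) fr G) + 2 * (fi G * Gam (pot 1 B) fi G) := by
      have h1 : ContDiff ℝ ∞ (fr * fr) := hfrC.mul hfrC
      have h2 : ContDiff ℝ ∞ (fi * fi) := hfiC.mul hfiC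
      rw [hF, Gam_add_right _ h1 h2, Gam_comm (pot 1 B) (fr * fr), Gam_comm (pot 1 B) (fi * fi),
        Gam_mul_left hfrC hfrC, Gam_mul_left hfiC hfiC, Gam_comm fr (pot 1 B), Gam_comm fi (pot 1 B)]
      ring
    have hGr : Gam (pot 1 B) fr G =
        -(1 / 2) * ((B * G * M₁ * G * M₂ * G).trace.re + (B * G * M₂ * G * M₁ * G).trace.re)
          + (1 / 2) * ((G * M₂ * Bᴴ * M₁).trace.re + (G * M₁ * Bᴴ * M₂).trace.re)
          - (2 / N) * (B * G).trace.im * (G * M₁ * G * M₂).trace.im := by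
      have h := Gam_potB_reTrQuad hN0 B M₁ M₂ g
      simpa only [hfr] using h
    have hGi : Gam (pot 1 B) fi G =
        -(1 / 2) * ((B * G * M₁ * G * M₂ * G).trace.im + (B * G * M₂ * G * M₁ * G).trace.im)
          + (1 / 2) * ((G * M₂ * Bᴴ * M₁).trace.im + (G * M₁ * Bᴴ * M₂).trace.im)
          - (2 / N) * (B * G).trace.im * (-(G * M₁ * G * M₂).trace.re) := by
      have h := Gam_potB_reTrQuad hN0 B M₁ ((-I) • M₂) g
      have e1 : (B * G * M₁ * G * ((-I) • M₂) * G).trace.re = (B * G * M₁ * G * M₂ * G).trace.im := by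
        simp only [Matrix.mul_smul, Matrix.smul_mul, trace_smul, smul_eq_mul, negI_mul_re]
      have e2 : (B * G * ((-I) • M₂) * G * M₁ * G).trace.re = (B * G * M₂ * G * M₁ * G).trace.im := by
        simp only [Matrix.mul_smul, Matrix.smul_mul, trace_smul, smul_eq_mul, negI_mul_re]
      have e3 : (G * ((-I) • M₂) * Bᴴ * M₁).trace.re = (G * M₂ * Bᴴ * M₁).trace.im := by
        simp only [Matrix.mul_smul, Matrix.smul_mul, trace_smul, smul_eq_mul, negI_mul_re]
      have e4 : (G * M₁ * Bᴴ * ((-I) • M₂)).trace.re = (G * M₁ * Bᴴ * M₂).trace.im := by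
        simp only [Matrix.mul_smul, trace_smul, smul_eq_mul, negI_mul_re]
      have e5 : (G * M₁ * G * ((-I) • M₂)).trace.im = -(G * M₁ * G * M₂).trace.re := imTrQuad_negI G M₁ M₂
      rw [← hG] at h
      simpa only [hfi, e1, e2, e3, e4, e5] using h
    have efr : fr G = (G * M₁ * G * M₂).trace.re := rfl
    have efi : fi G = (G * M₁ * G * M₂).trace.im := hfi_eq G
    have el1 : (G * M₂ * Bᴴ * M₁).trace = (G * (M₂ * Bᴴ * M₁)).trace := by simp only [Matrix.mul_assoc]
    have el2 : (G * M₁ * Bᴴ * M₂).trace = (G * (M₁ * Bᴴ * M₂)).trace := by simp only [Matrix.mul_assoc]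
    rw [hLap, hLr, hLi, hGamF, hGr, hGi, efr, efi, el1, el2, Complex.sq_norm, Complex.normSq_apply]
    simp only [Complex.mul_re, Complex.add_re, Complex.add_im, Complex.conj_re, Complex.conj_im, Complex.mul_im]
    ring
  -- (2) the pointwise inequality `2a|w|² ≤ −H + 4σ|z₁||z₂| + 2γ² + N|w|(κ + |ℓ₁| + |ℓ₂|)`
  have hpt : ∀ g : SUN N, 2 * a * ‖((g : Matrix (Fin N) (Fin N) ℂ) * M₁ * g * M₂).trace‖ ^ 2 ≤
      -(Lap F g + (N : ℝ) * Gam (pot 1 B) F g)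
        + 4 * σ * (‖((g : Matrix (Fin N) (Fin N) ℂ) * M₁).trace‖ * ‖((g : Matrix (Fin N) (Fin N) ℂ) * M₂).trace‖)
        + 2 * γ ^ 2
        + (N : ℝ) * (‖((g : Matrix (Fin N) (Fin N) ℂ) * M₁ * g * M₂).trace‖ *
            (κ + ‖((g : Matrix (Fin N) (Fin N) ℂ) * (M₂ * Bᴴ * M₁)).trace‖ + ‖((g : Matrix (Fin N) (Fin N) ℂ) * (M₁ * Bᴴ * M₂)).trace‖)) := by
    intro g
    have hg := SUN.mem_unitaryGroup g
    rw [hH g]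
    set w : ℂ := ((g : Matrix (Fin N) (Fin N) ℂ) * M₁ * g * M₂).trace with hw
    set z₁ : ℂ := ((g : Matrix (Fin N) (Fin N) ℂ) * M₁).trace with hz₁
    set z₂ : ℂ := ((g : Matrix (Fin N) (Fin N) ℂ) * M₂).trace with hz₂
    set ℓ₁ : ℂ := ((g : Matrix (Fin N) (Fin N) ℂ) * (M₂ * Bᴴ * M₁)).trace with hℓ₁
    set ℓ₂ : ℂ := ((g : Matrix (Fin N) (Fin N) ℂ) * (M₁ * Bᴴ * M₂)).trace with hℓ₂
    set c₁ : ℂ := (B * (g : Matrix (Fin N) (Fin N) ℂ) * M₁ * g * M₂ * g).trace with hc₁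
    set c₂ : ℂ := (B * (g : Matrix (Fin N) (Fin N) ℂ) * M₂ * g * M₁ * g).trace with hc₂
    -- |w| ≤ σ, the gradient bound, and the three Cauchy–Schwarz steps
    have hwσ : ‖w‖ ≤ σ := by
      rw [hw, hσ, show (g : Matrix (Fin N) (Fin N) ℂ) * M₁ * g * M₂ =
        ((g : Matrix (Fin N) (Fin N) ℂ) * M₁) * ((g : Matrix (Fin N) (Fin N) ℂ) * M₂) by simp only [Matrix.mul_assoc]]
      refine (norm_trace_mul_le _ _).trans ?_
      rw [frobNorm_unitary_mul hg, frobNorm_unitary_mul hg]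
    have hG2 : Gam fr fr g + Gam fi fi g ≤ γ ^ 2 :=
      (Gam_re_add_Gam_im_quad_le hN0 M₁ M₂ g).trans (pow_le_pow_left₀ (frobNorm_nonneg _) (hγ g) 2)
    have t1 : |((starRingEnd ℂ) w * (z₁ * z₂)).re| ≤ σ * (‖z₁‖ * ‖z₂‖) := by
      refine (abs_re_mul_le_norm_mul_norm _ _).trans ?_
      rw [Complex.norm_conj, norm_mul]
      exact mul_le_mul_of_nonneg_right hwσ (by positivity)
    have t2 : |((starRingEnd ℂ) w * (c₁ + c₂)).re| ≤ ‖w‖ * κ := by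
      refine (abs_re_mul_le_norm_mul_norm _ _).trans ?_
      rw [Complex.norm_conj]
      exact mul_le_mul_of_nonneg_left ((norm_add_le _ _).trans (hκ g)) (norm_nonneg _)
    have t3 : |((starRingEnd ℂ) w * (ℓ₁ + ℓ₂)).re| ≤ ‖w‖ * (‖ℓ₁‖ + ‖ℓ₂‖) := by
      refine (abs_re_mul_le_norm_mul_norm _ _).trans ?_
      rw [Complex.norm_conj]
      exact mul_le_mul_of_nonneg_left (norm_add_le _ _) (norm_nonneg _)
    have u1 := (abs_le.1 t1).1
    have u2 := (abs_le.1 t2).2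
    have u2' := (abs_le.1 t2).1
    have u3 := (abs_le.1 t3).2
    have u3' := (abs_le.1 t3).1
    nlinarith only [u1, u2, u2', u3, u3', hG2, hNpos.le, norm_nonneg w]
  -- (3) integrate: `∫ H = 0` (Schwinger–Dyson) and Cauchy–Schwarz
  have hLapC : Continuous fun g : SUN N => Lap F g := continuous_restrict (contDiff_Lap hFC)
  have hGamC : Continuous fun g : SUN N => Gam (pot 1 B) F g := continuous_restrict (contDiff_Gam (contDiff_pot 1 B) hFC)
  have hHC : Continuous fun g : SUN N => Lap F g + (N : ℝ) * Gam (pot 1 B) F g := hLapC.add (continuous_const.mul hGamC)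
  have hSD : ∫ g, (Lap F g + (N : ℝ) * Gam (pot 1 B) F g) ∂ν = 0 := by
    rw [integral_add (integrable_of_continuous_SUN hLapC ν) ((integrable_of_continuous_SUN hGamC ν).const_mul _),
      integral_const_mul]
    have h := integral_Lap_eq_neg hN0 B hFC
    rw [← hν] at h
    rw [h]; ring
  have cwn : Continuous fun g : SUN N => ‖((g : Matrix (Fin N) (Fin N) ℂ) * M₁ * g * M₂).trace‖ := continuous_norm.comp cw
  have cz1n : Continuous fun g : SUN N => ‖((g : Matrix (Fin N) (Fin N) ℂ) * M₁).trace‖ := continuous_norm.comp cz1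
  have cz2n : Continuous fun g : SUN N => ‖((g : Matrix (Fin N) (Fin N) ℂ) * M₂).trace‖ := continuous_norm.comp cz2
  have cl1n : Continuous fun g : SUN N => ‖((g : Matrix (Fin N) (Fin N) ℂ) * (M₂ * Bᴴ * M₁)).trace‖ := continuous_norm.comp cl1
  have cl2n : Continuous fun g : SUN N => ‖((g : Matrix (Fin N) (Fin N) ℂ) * (M₁ * Bᴴ * M₂)).trace‖ := continuous_norm.comp cl2
  have iw2 : Integrable (fun g : SUN N => ‖((g : Matrix (Fin N) (Fin N) ℂ) * M₁ * g * M₂).trace‖ ^ 2) ν :=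
    integrable_of_continuous_SUN (cwn.pow 2) ν
  have iH : Integrable (fun g : SUN N => Lap F g + (N : ℝ) * Gam (pot 1 B) F g) ν := integrable_of_continuous_SUN hHC ν
  have izz : Integrable (fun g : SUN N => ‖((g : Matrix (Fin N) (Fin N) ℂ) * M₁).trace‖ * ‖((g : Matrix (Fin N) (Fin N) ℂ) * M₂).trace‖) ν :=
    integrable_of_continuous_SUN (cz1n.mul cz2n) ν
  have iwl : Integrable (fun g : SUN N => ‖((g : Matrix (Fin N) (Fin N) ℂ) * M₁ * g * M₂).trace‖ *
      (κ + ‖((g : Matrix (Fin N) (Fin N) ℂ) * (M₂ * Bᴴ * M₁)).trace‖ + ‖((g : Matrix (Fin N) (Fin N) ℂ) * (M₁ * Bᴴ * M₂)).trace‖)) ν :=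
    integrable_of_continuous_SUN (cwn.mul ((continuous_const.add cl1n).add cl2n)) ν
  -- integrate the pointwise inequality
  have hint : 2 * a * ∫ g, ‖((g : Matrix (Fin N) (Fin N) ℂ) * M₁ * g * M₂).trace‖ ^ 2 ∂ν ≤
      -(∫ g, (Lap F g + (N : ℝ) * Gam (pot 1 B) F g) ∂ν)
        + 4 * σ * ∫ g, ‖((g : Matrix (Fin N) (Fin N) ℂ) * M₁).trace‖ * ‖((g : Matrix (Fin N) (Fin N) ℂ) * M₂).trace‖ ∂ν
        + 2 * γ ^ 2
        + (N : ℝ) * ∫ g, ‖((g : Matrix (Fin N) (Fin N) ℂ) * M₁ * g * M₂).trace‖ *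
            (κ + ‖((g : Matrix (Fin N) (Fin N) ℂ) * (M₂ * Bᴴ * M₁)).trace‖ + ‖((g : Matrix (Fin N) (Fin N) ℂ) * (M₁ * Bᴴ * M₂)).trace‖) ∂ν := by
    have iA : Integrable (fun g : SUN N => -(Lap F g + (N : ℝ) * Gam (pot 1 B) F g)) ν := iH.neg
    have iB : Integrable (fun g : SUN N =>
        4 * σ * (‖((g : Matrix (Fin N) (Fin N) ℂ) * M₁).trace‖ * ‖((g : Matrix (Fin N) (Fin N) ℂ) * M₂).trace‖)) ν := izz.const_mul _
    have iC : Integrable (fun _ : SUN N => 2 * γ ^ 2) ν := integrable_const _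
    have iD : Integrable (fun g : SUN N => (N : ℝ) * (‖((g : Matrix (Fin N) (Fin N) ℂ) * M₁ * g * M₂).trace‖ *
        (κ + ‖((g : Matrix (Fin N) (Fin N) ℂ) * (M₂ * Bᴴ * M₁)).trace‖ + ‖((g : Matrix (Fin N) (Fin N) ℂ) * (M₁ * Bᴴ * M₂)).trace‖))) ν :=
      iwl.const_mul _
    have iAB : Integrable (fun g : SUN N => -(Lap F g + (N : ℝ) * Gam (pot 1 B) F g)
        + 4 * σ * (‖((g : Matrix (Fin N) (Fin N) ℂ) * M₁).trace‖ * ‖((g : Matrix (Fin N) (Fin N) ℂ) * M₂).trace‖)) ν := iA.add iB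
    have iABC : Integrable (fun g : SUN N => -(Lap F g + (N : ℝ) * Gam (pot 1 B) F g)
        + 4 * σ * (‖((g : Matrix (Fin N) (Fin N) ℂ) * M₁).trace‖ * ‖((g : Matrix (Fin N) (Fin N) ℂ) * M₂).trace‖) + 2 * γ ^ 2) ν :=
      iAB.add iC
    have iAll : Integrable (fun g : SUN N => -(Lap F g + (N : ℝ) * Gam (pot 1 B) F g)
        + 4 * σ * (‖((g : Matrix (Fin N) (Fin N) ℂ) * M₁).trace‖ * ‖((g : Matrix (Fin N) (Fin N) ℂ) * M₂).trace‖) + 2 * γ ^ 2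
        + (N : ℝ) * (‖((g : Matrix (Fin N) (Fin N) ℂ) * M₁ * g * M₂).trace‖ *
          (κ + ‖((g : Matrix (Fin N) (Fin N) ℂ) * (M₂ * Bᴴ * M₁)).trace‖ + ‖((g : Matrix (Fin N) (Fin N) ℂ) * (M₁ * Bᴴ * M₂)).trace‖))) ν :=
      iABC.add iD
    have i2 : Integrable (fun g : SUN N => 2 * a * ‖((g : Matrix (Fin N) (Fin N) ℂ) * M₁ * g * M₂).trace‖ ^ 2) ν := iw2.const_mul _
    have h := integral_mono i2 iAll (fun g => hpt g)
    have hC' : ∫ _ : SUN N, (2 * γ ^ 2 : ℝ) ∂ν = 2 * γ ^ 2 := by simp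
    rw [integral_add iABC iD, integral_add iAB iC, integral_add iA iB, hC', integral_neg, integral_const_mul,
      integral_const_mul, integral_const_mul] at h
    linarith only [h]
  -- Cauchy–Schwarz on the three random pieces
  have hcs1 : ∫ g, ‖((g : Matrix (Fin N) (Fin N) ℂ) * M₁).trace‖ * ‖((g : Matrix (Fin N) (Fin N) ℂ) * M₂).trace‖ ∂ν ≤ Z₁ * Z₂ := by
    have h := abs_integral_mul_le_sqrt cz1n cz2n ν
    exact (le_abs_self _).trans h
  have hcsW : ∫ g, ‖((g : Matrix (Fin N) (Fin N) ℂ) * M₁ * g * M₂).trace‖ ∂ν ≤ W := by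
    have h := integral_abs_le_sqrt cwn ν
    simp only [abs_norm] at h
    exact h
  have hcsL1 : ∫ g, ‖((g : Matrix (Fin N) (Fin N) ℂ) * M₁ * g * M₂).trace‖ * ‖((g : Matrix (Fin N) (Fin N) ℂ) * (M₂ * Bᴴ * M₁)).trace‖ ∂ν ≤
      W * L₁ := (le_abs_self _).trans (abs_integral_mul_le_sqrt cwn cl1n ν)
  have hcsL2 : ∫ g, ‖((g : Matrix (Fin N) (Fin N) ℂ) * M₁ * g * M₂).trace‖ * ‖((g : Matrix (Fin N) (Fin N) ℂ) * (M₁ * Bᴴ * M₂)).trace‖ ∂ν ≤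
      W * L₂ := (le_abs_self _).trans (abs_integral_mul_le_sqrt cwn cl2n ν)
  have hsplit : ∫ g, ‖((g : Matrix (Fin N) (Fin N) ℂ) * M₁ * g * M₂).trace‖ *
      (κ + ‖((g : Matrix (Fin N) (Fin N) ℂ) * (M₂ * Bᴴ * M₁)).trace‖ + ‖((g : Matrix (Fin N) (Fin N) ℂ) * (M₁ * Bᴴ * M₂)).trace‖) ∂ν ≤
      κ * W + W * L₁ + W * L₂ := by
    have iwκ : Integrable (fun g : SUN N => ‖((g : Matrix (Fin N) (Fin N) ℂ) * M₁ * g * M₂).trace‖ * κ) ν :=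
      integrable_of_continuous_SUN (cwn.mul continuous_const) ν
    have iwl1 : Integrable (fun g : SUN N => ‖((g : Matrix (Fin N) (Fin N) ℂ) * M₁ * g * M₂).trace‖ *
        ‖((g : Matrix (Fin N) (Fin N) ℂ) * (M₂ * Bᴴ * M₁)).trace‖) ν := integrable_of_continuous_SUN (cwn.mul cl1n) ν
    have iwl2 : Integrable (fun g : SUN N => ‖((g : Matrix (Fin N) (Fin N) ℂ) * M₁ * g * M₂).trace‖ *
        ‖((g : Matrix (Fin N) (Fin N) ℂ) * (M₁ * Bᴴ * M₂)).trace‖) ν := integrable_of_continuous_SUN (cwn.mul cl2n) ν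
    have e : (fun g : SUN N => ‖((g : Matrix (Fin N) (Fin N) ℂ) * M₁ * g * M₂).trace‖ *
        (κ + ‖((g : Matrix (Fin N) (Fin N) ℂ) * (M₂ * Bᴴ * M₁)).trace‖ + ‖((g : Matrix (Fin N) (Fin N) ℂ) * (M₁ * Bᴴ * M₂)).trace‖)) =
        fun g : SUN N => (‖((g : Matrix (Fin N) (Fin N) ℂ) * M₁ * g * M₂).trace‖ * κ
          + ‖((g : Matrix (Fin N) (Fin N) ℂ) * M₁ * g * M₂).trace‖ * ‖((g : Matrix (Fin N) (Fin N) ℂ) * (M₂ * Bᴴ * M₁)).trace‖)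
          + ‖((g : Matrix (Fin N) (Fin N) ℂ) * M₁ * g * M₂).trace‖ * ‖((g : Matrix (Fin N) (Fin N) ℂ) * (M₁ * Bᴴ * M₂)).trace‖ := by
      funext g; ring
    have i12 : Integrable (fun g : SUN N => ‖((g : Matrix (Fin N) (Fin N) ℂ) * M₁ * g * M₂).trace‖ * κ
        + ‖((g : Matrix (Fin N) (Fin N) ℂ) * M₁ * g * M₂).trace‖ * ‖((g : Matrix (Fin N) (Fin N) ℂ) * (M₂ * Bᴴ * M₁)).trace‖) ν :=
      iwκ.add iwl1
    rw [e, integral_add i12 iwl2, integral_add iwκ iwl1, integral_mul_const]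
    have hκW : (∫ g, ‖((g : Matrix (Fin N) (Fin N) ℂ) * M₁ * g * M₂).trace‖ ∂ν) * κ ≤ κ * W := by
      rw [mul_comm]; exact mul_le_mul_of_nonneg_left hcsW hκ0
    linarith only [hκW, hcsL1, hcsL2]
  rw [hSD] at hint
  have hW0 : 0 ≤ W := Real.sqrt_nonneg _
  have hWW : W ^ 2 = ∫ g, ‖((g : Matrix (Fin N) (Fin N) ℂ) * M₁ * g * M₂).trace‖ ^ 2 ∂ν :=
    Real.sq_sqrt (integral_nonneg fun g => sq_nonneg _)
  rw [← hWW] at hint ⊢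
  have m1 := mul_le_mul_of_nonneg_left hcs1 (by positivity : (0 : ℝ) ≤ 4 * σ)
  have m2 := mul_le_mul_of_nonneg_left hsplit hNpos.le
  nlinarith only [hint, m1, m2]

end Summit.Ventures.YMGap.OneLinkEigen
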